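import Mathlib.Analysis.SpecificLimits.Basic
import Literature.Barriers.PneNP.LocalityKernel
import Literature.Barriers.PneNP.LocalityAsymptotics
import HarnessLib

/-!
# Proof of the locality barrier fact `Locality` (CHOPRS Prop. 50, E1^𝒪)

`theorem Locality_holds : Locality` — the discharge of the named fact
`Literature.Barriers.PneNP.Locality` [arXiv191108297, Prop. 50 (E1^𝒪), p. 27]: for every
`k = ⌊(log₂ n)^C⌋` and every depth `d ≥ d₀(C) = 48C + 59`, `(n-k)`-Clique has depth-`d`
circuits of size `⌈m^{1+1/(d+1)}⌉` over `∧, ∨, ¬` and ONE oracle gate of fan-in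
`≤ 12 (log₂ n + 1)^{4C}`, for all large `n`.

The printed proof ("by inspection of the proof of Prop. 31, which relies on the circuit
construction from [OS18] … the circuit simulates a well-known kernelization algorithm for
`k`-Vertex-Cover … `(H, k_H)` becomes the input string to the single oracle") is carried out
in full in the tree's straight-line circuit model:

* `LocalityCircuit` / `LocalityKernel`: ONE multi-output `acBasis` circuit of depth `6r + 10`
  and size `kernelSize n k b r` computing the kernel bits (Buss' kernel, thresholds by
  perfect hashing, layers composed with sharing);
* here: the oracle gate on top (`exists_isLocalAC_of_acVec`: a circuit with `≤ 1` non-`AC`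
  gate, of fan-in the number of kernel bits), the oracle language `{ofFn β | Φ k β}` decoding
  the answer from the kernel bits (`phi_kernelBits`: Buss' kernel theorem
  `not_cliqueFree_iff_kernel`), the size estimate `kernelSize + 1 ≤ n² 2^{O_C(log ℓ √ℓ)}`
  (`kernelSize_succ_le`) with `ℓ = log₂ n + 1`, tree parameters `b = √ℓ + 1`, `r = 8C + 8`,
  and the assembly with the asymptotics of `LocalityAsymptotics`.

(The sibling `LocalityProofs.lean` is the discharge of the companion fact E3^𝒪,
`Locality_parityLocalizes_holds`.)

## References

* [arXiv191108297] L. Chen, S. Hirahara, I. C. Oliveira, J. Pich, N. Rajgopal, R. Santhanam,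
  *Beyond natural proofs: hardness magnification and locality*, ITCS 2020 / J. ACM 2022:
  Prop. 50 and its proof, p. 27; Def. 11 (local circuit classes); Appendix A, Prop. 63, p. 37.
* I. C. Oliveira, R. Santhanam, *Hardness magnification for natural problems*, FOCS 2018.
-/

noncomputable section

open Classical Filter Finset
open _root_.Topology
open Literature.Computability.Complexity Literature.Computability.Complexity.GateList
open Literature.Combinatorics.SimpleGraph

namespace Literature.Barriers.PneNP.Locality

/-! ### The oracle gate on top of a shared `AC⁰` circuit -/

/-- Weakening all four budgets (depth included) of a local circuit. [folklore] -/
theorem isLocalAC_weaken {ι : Type*} {E : Circuit ι} {𝒪 : Language Bool}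
    {d s q ℓ d' s' q' ℓ' : ℕ} (h : E.IsLocalAC 𝒪 d s q ℓ) (hd : d ≤ d') (hs : s ≤ s')
    (hq : q ≤ q') (hℓ : ℓ ≤ ℓ') : E.IsLocalAC 𝒪 d' s' q' ℓ' :=
  ⟨h.1, h.2.1.trans hd, h.2.2.1.trans hs, h.2.2.2.1.trans hq,
    fun g hg hno => (h.2.2.2.2 g hg hno).trans hℓ⟩

/-- **One oracle gate on top.** If the `M` Boolean maps `x ↦ f x j` are computed by one
multi-output circuit over `acBasis` of depth `d` and size `s` (`ACVec`), then appending a single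
`𝒪`-gate of fan-in `M` reading its outputs gives a local `AC⁰` oracle circuit (Def. 11 of
Chen et al.: at most one gate outside `acBasis`, of fan-in `M`) of depth `d + 1` and size
`s + 1` computing `x ↦ 𝒪(f x)`. [cite: arXiv191108297, Def. 11 (§2.5)] -/
theorem exists_isLocalAC_of_acVec {ι : Type*} {M : ℕ} {f : (ι → Bool) → Fin M → Bool}
    {d s : ℕ} (h : ACVec f d s) (𝒪 : Language Bool) :
    ∃ E : Circuit ι, E.IsLocalAC 𝒪 (d + 1) (s + 1) 1 M ∧
      E.Computes fun x => 𝒪.sliceFn M (f x) := by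
  obtain ⟨gs, o, hwf, hB, ho, hl, hdep, hev⟩ := h
  let g : Gate ι := ⟨M, 𝒪.sliceFn M, o⟩
  have hwf' : WF (gs ++ [g]) := hwf.append_singleton fun a m hm => ho a m hm
  refine ⟨⟨gs ++ [g], .inr gs.length,
    fun j hj a m ha => hwf' j _ (List.getElem?_eq_getElem hj) a m ha,
    fun m hm => by cases hm; simp⟩, ⟨?_, ?_, ?_, ?_, ?_⟩, fun x => ?_⟩
  · intro g' hg'
    simp only [List.mem_append, List.mem_singleton] at hg'
    rcases hg' with hg' | rfl
    · exact Or.inl (hB g' hg')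
    · exact Or.inr ⟨M, rfl⟩
  · change Circuit.depthWith _ acWeight ≤ d + 1
    rw [circuit_depthWith]
    show wireDepthOf (wdepths acWeight (gs ++ [g])) (Sum.inr gs.length) ≤ d + 1
    rw [wireDepthOf_inr, getD_wdepths_append_singleton, add_comm]
    exact Nat.add_le_add (Finset.sup_le fun a _ => hdep a) (acWeight_le_one _)
  · show (gs ++ [g]).length ≤ s + 1
    simpa using hl
  · show (gs ++ [g]).countP (fun g => g.fn ∉ acBasis) ≤ 1
    rw [List.countP_append, List.countP_eq_zero.2 fun g' hg' => by simp [hB g' hg'], zero_add]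
    exact (List.countP_le_length).trans (le_of_eq (List.length_singleton))
  · intro g' hg' hno
    simp only [List.mem_append, List.mem_singleton] at hg'
    rcases hg' with hg' | rfl
    · exact (hno (hB g' hg')).elim
    · exact le_rfl
  · show (Circuit.wireVals _ x).getD gs.length false = _
    rw [circuit_wireVals]
    show (vals (gs ++ [g]) x).getD gs.length false = _
    rw [vals_append_singleton, List.getD_eq_getElem?_getD,
      List.getElem?_append_right (by simp), length_vals, Nat.sub_self]
    simp only [List.getElem?_cons_zero, Option.getD_some]
    exact congrArg (𝒪.sliceFn M) (funext fun a => hev x a)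

/-! ### The oracle: deciding `(n-k)`-Clique from the kernel bits -/

/-- The number of kernel bits `|KB k| = (k + 1) + 1 + (2k² + 1)²`. [folklore] -/
theorem card_KB (k : ℕ) : Fintype.card (KB k) = (k + 1) + 1 + (2 * k ^ 2 + 1) ^ 2 := by
  simp only [KB, Fintype.card_sum, Fintype.card_prod, Fintype.card_fin, Fintype.card_unit]
  ring

/-- `k ↦ |KB k|` is injective (the oracle reads `k` off the input length). [folklore] -/
theorem card_KB_injective : Function.Injective fun k => Fintype.card (KB k) := by
  have h : (fun k => Fintype.card (KB k)) = fun k => (k + 2) + (2 * k ^ 2 + 1) ^ 2 := by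
    funext k; rw [card_KB]
  rw [h]
  refine (StrictMono.add_monotone (fun a b hab => by omega) fun a b hab => ?_).injective
  exact Nat.pow_le_pow_left (by nlinarith [Nat.pow_le_pow_left hab 2]) 2

/-- The oracle's decision on kernel bits `β`: `|high| ≤ k` (the last unary bit is off), no kernel
overflow, and the kernel graph read off the adjacency bits has a vertex cover with at most
`k - |high|` vertices, `|high|` being the number of unary bits that are on.
[cite: arXiv191108297, proof of Prop. 50 p. 27] -/
def Phi (k : ℕ) (β : KB k → Bool) : Prop :=
  β (.inl (Fin.last k)) = false ∧ β (.inr (.inl ())) = false ∧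
    ∃ T : Finset (Fin (2 * k ^ 2 + 1)),
      T.card ≤ k - (univ.filter fun i : Fin (k + 1) => β (.inl i) = true).card ∧
        ∀ i j, β (.inr (.inr (i, j))) = true → i ∈ T ∨ j ∈ T

/-- The oracle language: encodings `ofFn β` (through the canonical enumeration of `KB k`) of
kernel-bit vectors accepted by `Phi k`, over all `k`.
[cite: arXiv191108297, proof of Prop. 50 p. 27] -/
def oracle : Language Bool :=
  {w | ∃ (k : ℕ) (β : KB k → Bool),
    w = List.ofFn (fun m => β ((Fintype.equivFin (KB k)).symm m)) ∧ Phi k β}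

/-- **The kernel bits determine the answer** (Buss' kernel theorem): for `k ≤ n`,
`Phi k (kernelBits k x) ↔ G_x` has a clique on `n - k` vertices.
[cite: arXiv191108297, proof of Prop. 50 p. 27] -/
theorem phi_kernelBits {n k : ℕ} (hk : k ≤ n) (x : (⊤ : SimpleGraph (Fin n)).edgeSet → Bool) :
    Phi k (kernelBits k x) ↔ ¬ (cliqueGraph x).CliqueFree (n - k) := by
  rw [not_cliqueFree_iff_kernel (G := cliqueGraph x) hk (Nat.le_succ _), Phi]
  have hhigh : kernelBits k x (.inl (Fin.last k)) = false ↔ (high (cliqueGraph x) k).card ≤ k := by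
    simp [kernelBits]
  have hker : kernelBits k x (.inr (.inl ())) = false ↔
      (ker (cliqueGraph x) k).card ≤ 2 * k ^ 2 := by
    simp [kernelBits]
  rw [hhigh, hker]
  refine and_congr_right fun hh => and_congr_right fun _ => ?_
  have hcount : (univ.filter fun i : Fin (k + 1) => kernelBits k x (.inl i) = true).card =
      (high (cliqueGraph x) k).card := by
    have : (univ.filter fun i : Fin (k + 1) => kernelBits k x (.inl i) = true) =
        univ.filter fun i : Fin (k + 1) => (i : ℕ) < (high (cliqueGraph x) k).card := by
      ext i; simp [kernelBits]
    rw [this, ← Fintype.card_subtype, Fintype.card_fin_lt_of_le (by omega)]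
  rw [hcount]
  refine exists_congr fun T => and_congr_right fun _ => ?_
  simp only [kernelBits, decide_eq_true_eq, SimpleGraph.IsVertexCover, kerGraph_adj, mem_coe]

/-- The oracle gate applied to the kernel bits of `x` answers `(n-k)`-Clique.
[cite: arXiv191108297, proof of Prop. 50 p. 27] -/
theorem oracle_sliceFn_kernelBits {n k : ℕ} (hk : k ≤ n)
    (x : (⊤ : SimpleGraph (Fin n)).edgeSet → Bool) :
    oracle.sliceFn (Fintype.card (KB k))
        (fun m => kernelBits k x ((Fintype.equivFin (KB k)).symm m)) = cliqueFn n (n - k) x := by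
  rw [cliqueFn_eq, Language.sliceFn]
  have hmem : List.ofFn (fun m => kernelBits k x ((Fintype.equivFin (KB k)).symm m)) ∈ oracle ↔
      Phi k (kernelBits k x) := by
    constructor
    · rintro ⟨k', β, hw, hΦ⟩
      have hlen := congrArg List.length hw
      simp only [List.length_ofFn] at hlen
      have hkk : k = k' := card_KB_injective hlen
      subst hkk
      have hβ := List.ofFn_injective hw
      have : kernelBits k x = β := by
        funext κ
        simpa using congrFun hβ (Fintype.equivFin (KB k) κ)
      rwa [this]
    · exact fun h => ⟨k, kernelBits k x, rfl, h⟩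
  by_cases h : Phi k (kernelBits k x)
  · rw [(Set.mem_iff_boolIndicator _ _).1 (hmem.2 h)]
    exact (decide_eq_true ((phi_kernelBits hk x).1 h)).symm
  · rw [(Set.notMem_iff_boolIndicator _ _).1 (fun h' => h (hmem.1 h'))]
    symm
    exact decide_eq_false fun h' => h ((phi_kernelBits hk x).2 h')

/-! ### Size of the kernel circuit -/

/-- `kernelSize + 1 ≤ 24 (n+1)² (2k²+2)² A^r` with `A = (2k²+2)^b (b+1) + 1`. [folklore] -/
theorem kernelSize_succ_le (n k b r : ℕ) :
    kernelSize n k b r + 1 ≤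
      24 * (n + 1) ^ 2 * (2 * k ^ 2 + 2) ^ 2 * ((2 * k ^ 2 + 2) ^ b * (b + 1) + 1) ^ r := by
  set N := n + 1 with hN
  set P := 2 * k ^ 2 + 2 with hP
  set Ar := ((2 * k ^ 2 + 2) ^ b * (b + 1) + 1) ^ r with hAr
  have hN1 : 1 ≤ N := by omega
  have hP1 : 2 ≤ P := by omega
  have hAr1 : 1 ≤ Ar := Nat.one_le_pow _ _ (by omega)
  have hkP : k + 1 ≤ P := by nlinarith
  have hT : gadgetSize n k b r ≤ 2 * N * Ar := by
    unfold gadgetSize; rw [← hAr, ← hN]; nlinarith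
  have h1 : n + (k + 1) + (1 + n * (2 * k ^ 2 + 2)) ≤ 3 * N * P := by rw [← hP]; nlinarith
  have h2 : n * (2 * n + 4) ≤ 2 * N ^ 2 := by rw [hN]; nlinarith
  have h3 : (2 * k ^ 2 + 1) ^ 2 * (13 * n ^ 2 + 1) ≤ 14 * N ^ 2 * P ^ 2 := by
    have : (2 * k ^ 2 + 1) ^ 2 ≤ P ^ 2 := Nat.pow_le_pow_left (by omega) 2
    have : 13 * n ^ 2 + 1 ≤ 14 * N ^ 2 := by rw [hN]; nlinarith
    nlinarith
  have h4 : n ^ 2 + 1 ≤ 2 * N ^ 2 := by rw [hN]; nlinarith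
  unfold kernelSize
  set X := N ^ 2 * P ^ 2 * Ar with hX
  have hP2 : P ≤ P ^ 2 := by rw [sq]; exact Nat.le_mul_of_pos_right _ (by omega)
  have hPA : 1 ≤ P ^ 2 * Ar := Nat.mul_le_mul (Nat.one_le_pow 2 P (by omega)) hAr1
  have e1 : 3 * N * P * (2 * N * Ar) ≤ 6 * X := by
    rw [hX, show 3 * N * P * (2 * N * Ar) = 6 * (N ^ 2 * P * Ar) by ring]
    exact Nat.mul_le_mul_left 6 (Nat.mul_le_mul_right _ (Nat.mul_le_mul_left _ hP2))
  have e2 : N ^ 2 ≤ X := by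
    rw [hX, mul_assoc]; exact Nat.le_mul_of_pos_right _ hPA
  have e3 : 14 * N ^ 2 * P ^ 2 ≤ 14 * X := by
    rw [hX, show 14 * N ^ 2 * P ^ 2 = 14 * (N ^ 2 * P ^ 2) by ring]
    exact Nat.mul_le_mul_left 14 (Nat.le_mul_of_pos_right _ hAr1)
  calc (n + (k + 1) + (1 + n * (2 * k ^ 2 + 2))) * gadgetSize n k b r + n * (2 * n + 4) +
        (2 * k ^ 2 + 1) ^ 2 * (13 * n ^ 2 + 1) + n ^ 2 + 1
      ≤ (3 * N * P) * (2 * N * Ar) + 2 * N ^ 2 + 14 * N ^ 2 * P ^ 2 + 2 * N ^ 2 := by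
        have := Nat.mul_le_mul h1 hT; omega
    _ ≤ 6 * X + 2 * X + 14 * X + 2 * X := by omega
    _ = 24 * N ^ 2 * P ^ 2 * Ar := by rw [hX]; ring

/-- `b + 2 ≤ 2^(b+1)`. [folklore] -/
theorem add_two_le_two_pow_succ (b : ℕ) : b + 2 ≤ 2 ^ (b + 1) := by
  induction b with
  | zero => norm_num
  | succ b ih => rw [pow_succ]; omega

/-- The exponent bound: if `ℓ < 2^L` and `k ≤ ℓ^C` then
`24 (n+1)² (2k²+2)² A^r ≤ n² · 2^q` for `q = 11 + 4CL + r((3 + 2CL) b + 1)` (`n ≥ 1`). [folklore] -/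
theorem size_le_pow_two {n k b r C ℓ L : ℕ} (hn : 1 ≤ n) (hk : k ≤ ℓ ^ C) (hℓ : 1 ≤ ℓ)
    (hℓL : ℓ < 2 ^ L) :
    24 * (n + 1) ^ 2 * (2 * k ^ 2 + 2) ^ 2 * ((2 * k ^ 2 + 2) ^ b * (b + 1) + 1) ^ r ≤
      n ^ 2 * 2 ^ (11 + 4 * C * L + r * ((3 + 2 * C * L) * b + 1)) := by
  -- `P = 2k² + 2 ≤ 4 ℓ^{2C} ≤ 2^{2 + 2CL}`
  have hP : 2 * k ^ 2 + 2 ≤ 2 ^ (2 + 2 * C * L) := by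
    have hk2 : k ^ 2 ≤ (ℓ ^ C) ^ 2 := Nat.pow_le_pow_left hk 2
    have hℓC : (ℓ ^ C) ^ 2 ≤ (2 ^ L) ^ (2 * C) := by
      rw [← pow_mul, mul_comm]; exact Nat.pow_le_pow_left hℓL.le _
    have h1 : 1 ≤ (ℓ ^ C) ^ 2 := Nat.one_le_pow _ _ (Nat.one_le_pow _ _ hℓ)
    calc 2 * k ^ 2 + 2 ≤ 4 * (ℓ ^ C) ^ 2 := by omega
      _ ≤ 4 * (2 ^ L) ^ (2 * C) := Nat.mul_le_mul_left 4 hℓC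
      _ = 2 ^ (2 + 2 * C * L) := by
          rw [← pow_mul, show 2 + 2 * C * L = 2 + L * (2 * C) by ring, pow_add]; norm_num
  -- `A ≤ P^b (b + 2) ≤ 2^{(2+2CL) b + (b+1)}`
  have hA : (2 * k ^ 2 + 2) ^ b * (b + 1) + 1 ≤ 2 ^ ((3 + 2 * C * L) * b + 1) := by
    have hPb : (2 * k ^ 2 + 2) ^ b ≤ 2 ^ ((2 + 2 * C * L) * b) := by
      rw [pow_mul]; exact Nat.pow_le_pow_left hP b
    have h1 : 1 ≤ (2 * k ^ 2 + 2) ^ b := Nat.one_le_pow _ _ (by omega)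
    calc (2 * k ^ 2 + 2) ^ b * (b + 1) + 1 ≤ (2 * k ^ 2 + 2) ^ b * (b + 2) := by
          rw [show (2 * k ^ 2 + 2) ^ b * (b + 2) =
            (2 * k ^ 2 + 2) ^ b * (b + 1) + (2 * k ^ 2 + 2) ^ b by ring]
          omega
      _ ≤ 2 ^ ((2 + 2 * C * L) * b) * 2 ^ (b + 1) :=
          Nat.mul_le_mul hPb (add_two_le_two_pow_succ b)
      _ = 2 ^ ((3 + 2 * C * L) * b + 1) := by rw [← pow_add]; ring_nf
  have hAr : ((2 * k ^ 2 + 2) ^ b * (b + 1) + 1) ^ r ≤ 2 ^ (r * ((3 + 2 * C * L) * b + 1)) := by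
    rw [mul_comm r, pow_mul]; exact Nat.pow_le_pow_left hA r
  have hN : (n + 1) ^ 2 ≤ 2 ^ 2 * n ^ 2 := by nlinarith
  have hP2 : (2 * k ^ 2 + 2) ^ 2 ≤ 2 ^ (2 * (2 + 2 * C * L)) := by
    rw [mul_comm 2 (2 + 2 * C * L), pow_mul]; exact Nat.pow_le_pow_left hP 2
  calc 24 * (n + 1) ^ 2 * (2 * k ^ 2 + 2) ^ 2 * ((2 * k ^ 2 + 2) ^ b * (b + 1) + 1) ^ r
      ≤ 2 ^ 5 * (2 ^ 2 * n ^ 2) * 2 ^ (2 * (2 + 2 * C * L)) *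
          2 ^ (r * ((3 + 2 * C * L) * b + 1)) := by
        gcongr; norm_num
    _ = n ^ 2 * 2 ^ (11 + 4 * C * L + r * ((3 + 2 * C * L) * b + 1)) := by
        rw [show 11 + 4 * C * L + r * ((3 + 2 * C * L) * b + 1) =
          5 + 2 + 2 * (2 + 2 * C * L) + r * ((3 + 2 * C * L) * b + 1) by ring]
        simp only [pow_add]; ring

/-! ### The main theorem -/

/-- **CHOPRS Prop. 50 (E1^𝒪), proved.** For every `C ≥ 1`, with `ε_d = 1/(d+1) → 0` and
`d₀ = 48C + 59`: for every `d ≥ d₀` and all large `n`, `(n-k)`-Clique (`k = ⌊(log₂ n)^C⌋`) is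
computed by a depth-`d` circuit over `∧, ∨, ¬` and ONE `oracle`-gate of fan-in
`≤ 12 (log₂ n + 1)^{4C}`, of size `≤ ⌈(n choose 2)^{1+ε_d}⌉`: the kernelization circuit
(`acVec_kernelBits`) with tree parameters `b = √ℓ + 1`, `r = 8C + 8` (`ℓ = log₂ n + 1`),
topped by the oracle gate (`exists_isLocalAC_of_acVec`), which answers correctly by
`oracle_sliceFn_kernelBits`; the size is `n² 2^{O_C(log ℓ · √ℓ)} ≤ (n choose 2)^{1+ε_d}`
eventually (`kernelSize_succ_le`, `size_le_pow_two`, `eventually_log_mul_sqrt_le`,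
`le_ceil_choose_two_rpow`). [cite: arXiv191108297, Prop. 50 (E1^𝒪) p. 27] -/
theorem _root_.Literature.Barriers.PneNP.Locality_holds : Locality := by
  intro C hC
  refine ⟨fun d => 1 / ((d : ℝ) + 1), tendsto_one_div_add_atTop_nhds_zero_nat, 48 * C + 59,
    fun d hd => ⟨oracle, 12, ?_⟩⟩
  set r := 8 * C + 8 with hr
  -- the constant of the exponent bound and the events "n is large"
  set c₃ := (d + 1) * (13 + 4 * C + r * (3 + 2 * C + 1)) with hc₃
  have ev1 := tendsto_log_two_succ.eventually (eventually_log_mul_sqrt_le c₃)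
  have ev2 := tendsto_log_two_succ.eventually (eventually_pow_le_two_pow 1 C)
  have ev3 := tendsto_log_two_succ.eventually (eventually_ge_atTop 2)
  filter_upwards [ev1, ev2, ev3, eventually_ge_atTop 3] with n hn1 hn2 hℓ2 hn3
  -- parameters
  set ℓ := Nat.log 2 n + 1 with hℓ
  set k := ⌊Real.logb 2 n ^ C⌋₊ with hk
  set b := Nat.sqrt ℓ + 1 with hb
  have hkK : k ≤ ℓ ^ C := floor_logb_pow_le n C
  have hK1 : 1 ≤ ℓ ^ C := Nat.one_le_pow _ _ (by omega)
  have hkn : k ≤ n := by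
    refine hkK.trans ?_
    have h := hn2
    rw [one_mul] at h
    exact h.trans (Nat.pow_log_le_self 2 (by omega))
  -- `K = ℓ^C`: `2k² + 1 ≤ 3K²`, `(2k²+1)² ≤ 9K⁴`
  have hK2 : k ^ 2 ≤ (ℓ ^ C) ^ 2 := Nat.pow_le_pow_left hkK 2
  have hK21 : 1 ≤ (ℓ ^ C) ^ 2 := Nat.one_le_pow _ _ hK1
  have hΘ : 2 * k ^ 2 + 1 ≤ 3 * (ℓ ^ C) ^ 2 := by omega
  have hΘ2 : (2 * k ^ 2 + 1) ^ 2 ≤ 9 * ((ℓ ^ C) ^ 2) ^ 2 := by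
    calc (2 * k ^ 2 + 1) ^ 2 ≤ (3 * (ℓ ^ C) ^ 2) ^ 2 := Nat.pow_le_pow_left hΘ 2
      _ = 9 * ((ℓ ^ C) ^ 2) ^ 2 := by ring
  have hK4 : ((ℓ ^ C) ^ 2) ^ 2 = ℓ ^ (4 * C) := by rw [← pow_mul, ← pow_mul]; ring_nf
  -- `2 (2k²+1)² < b^r`
  have hbr : 2 * (2 * k ^ 2 + 1) ^ 2 < b ^ r := by
    have h2 : ℓ + 1 ≤ b ^ 2 := by
      rw [hb, sq]; exact Nat.succ_le_of_lt (Nat.lt_succ_sqrt ℓ)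
    have h3 : (ℓ + 1) ^ (4 * C + 4) ≤ b ^ r := by
      rw [hr, show 8 * C + 8 = 2 * (4 * C + 4) by ring, pow_mul]
      exact Nat.pow_le_pow_left h2 _
    have h4 : 18 * ℓ ^ (4 * C) < (ℓ + 1) ^ (4 * C + 4) := by
      have h81 : 81 ≤ (ℓ + 1) ^ 4 := by
        calc 81 = 3 ^ 4 := by norm_num
          _ ≤ (ℓ + 1) ^ 4 := Nat.pow_le_pow_left (by omega) 4
      have hℓC : ℓ ^ (4 * C) ≤ (ℓ + 1) ^ (4 * C) := Nat.pow_le_pow_left (Nat.le_succ ℓ) _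
      have hpos : 1 ≤ ℓ ^ (4 * C) := Nat.one_le_pow _ _ (by omega)
      have hm := Nat.mul_le_mul hℓC h81
      rw [← pow_add] at hm
      omega
    rw [hK4] at hΘ2
    omega
  -- the circuit
  have hvec := (acVec_kernelBits (n := n) k b r hbr (by omega)).outMap
    (Fintype.equivFin (KB k)).symm
  obtain ⟨E, hE, hcomp⟩ := exists_isLocalAC_of_acVec hvec oracle
  refine ⟨E, isLocalAC_weaken hE (by omega) ?_ le_rfl ?_, fun x => ?_⟩
  · -- size
    set L := Nat.log 2 ℓ + 1 with hL
    have hℓL : ℓ < 2 ^ L := Nat.lt_pow_succ_log_self (by norm_num) ℓ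
    refine le_ceil_choose_two_rpow ((kernelSize_succ_le n k b r).trans
      (size_le_pow_two (C := C) (by omega) hkK (by omega) hℓL)) hn3 ?_
    -- `(d+1)(q+2) ≤ log₂ n = ℓ - 1`
    have hL1 : 1 ≤ L := by omega
    have hb1 : 1 ≤ b := by omega
    set X := L * b with hX
    have hX1 : 1 ≤ X := Nat.mul_le_mul hL1 hb1
    have eL : L ≤ X := Nat.le_mul_of_pos_right _ hb1
    have eb : b ≤ X := Nat.le_mul_of_pos_left _ hL1
    have hq : 11 + 4 * C * L + r * ((3 + 2 * C * L) * b + 1) + 2 ≤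
        (13 + 4 * C + r * (3 + 2 * C + 1)) * X := by
      have e1 : 4 * C * L ≤ 4 * C * X := Nat.mul_le_mul_left _ eL
      have e2 : (3 + 2 * C * L) * b + 1 ≤ (3 + 2 * C + 1) * X := by
        have : (3 + 2 * C * L) * b = 3 * b + 2 * C * X := by rw [hX]; ring
        rw [this]
        have : 3 * b ≤ 3 * X := Nat.mul_le_mul_left 3 eb
        nlinarith
      have e3 : r * ((3 + 2 * C * L) * b + 1) ≤ r * ((3 + 2 * C + 1) * X) :=
        Nat.mul_le_mul_left r e2
      nlinarith
    have : c₃ * L * b + 1 ≤ ℓ := hn1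
    have hlog : Nat.log 2 n = ℓ - 1 := by omega
    rw [hlog]
    calc (d + 1) * (11 + 4 * C * L + r * ((3 + 2 * C * L) * b + 1) + 2)
        ≤ (d + 1) * ((13 + 4 * C + r * (3 + 2 * C + 1)) * X) := Nat.mul_le_mul_left _ hq
      _ = c₃ * L * b := by rw [hc₃, hX]; ring
      _ ≤ ℓ - 1 := by omega
  · -- fan-in `|KB k| ≤ 12 (log₂ n + 1)^{4C}`
    rw [card_KB]
    have hkK4 : k ≤ ((ℓ ^ C) ^ 2) ^ 2 :=
      hkK.trans ((Nat.le_self_pow two_ne_zero _).trans (Nat.le_self_pow two_ne_zero _))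
    have h1 : 1 ≤ ((ℓ ^ C) ^ 2) ^ 2 := Nat.one_le_pow _ _ hK21
    calc k + 1 + 1 + (2 * k ^ 2 + 1) ^ 2 ≤ 12 * ((ℓ ^ C) ^ 2) ^ 2 := by omega
      _ = 12 * (Nat.log 2 n + 1) ^ (4 * C) := by rw [hK4]
  · -- correctness
    rw [hcomp x]
    exact oracle_sliceFn_kernelBits hkn x

end Literature.Barriers.PneNP.Locality

end
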